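import Mathlib.Algebra.Polynomial.Identities
import Mathlib.Algebra.Polynomial.Derivative
import Mathlib.Algebra.Polynomial.Div
import HarnessLib

/-!
# Newton–Hensel lifting of a simple root to a truncated power series root

Abstract form of the first step of Kaltofen's effective Hilbert irreducibility argument
(Cafure–Matera 2006, §3.2; [Kal95, §3]): let `A` be a commutative ring and `χ ∈ A[Y][X]`
(a polynomial in `X` over `A[Y]`; `Y` is `Polynomial.X` of the inner ring, `X` of the outer).
Suppose `α ∈ A` is an *approximate simple root modulo `Y`*: `Y ∣ χ(α)` and
`Y ∣ 1 - u·χ'(α)` for some `u ∈ A` (i.e. `u` inverts `∂χ/∂X (α)` modulo `Y`). Then for every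
`k` there is `a ∈ A[Y]` with `a ≡ α (mod Y)` and `χ(a) ≡ 0 (mod Y^{k+1})`
(`exists_approxRoot`), obtained by the simplified Newton iteration `a ↦ a - u χ(a)`; moreover
`a` can be taken inside any set of "admissible" elements of `A[Y]` containing `α` and stable under
the iteration step (`exists_approxRoot_of_invariant`), which is how degree bounds on the
coefficients of `a` are carried along in the sibling files. Only the Taylor expansion to second
order (`Polynomial.binomExpansion`) is used; no completeness or power series are needed since a
fixed finite precision suffices downstream.

## References

* E. Kaltofen, J. Comput. System Sci. 50 (1995) 274–295, §3 (Newton iteration for the root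
  `αᵢ(Y)`). [Kaltofen1995]
* A. Cafure, G. Matera, Finite Fields Appl. 12 (2006) 155–185, §3.2. [CafureMatera2006]
-/

noncomputable section

open scoped Classical Polynomial
open Polynomial

namespace Literature.NumberTheory.DiophantineGeometry

universe u

variable {A : Type u} [CommRing A]

/-- Congruent arguments give congruent values: `Y ∣ a - b ⇒ Y ∣ P(a) - P(b)`, and more generally
for any divisor. [folklore] -/
theorem dvd_eval_sub_eval {d a b : A[X]} (h : d ∣ a - b) (P : Polynomial A[X]) :
    d ∣ P.eval a - P.eval b :=
  h.trans (sub_dvd_eval_sub a b P)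

/-- **One step of the simplified Newton iteration.** If `Y^m ∣ χ(a)` (`m ≥ 1`) and
`Y ∣ 1 - u χ'(a)`, then `Y^{m+1} ∣ χ(a - u χ(a))`: by Taylor,
`χ(a - uχ(a)) = χ(a)(1 - uχ'(a)) + (uχ(a))² r`. [folklore] -/
theorem newton_step (χ : Polynomial A[X]) (u : A[X]) {a : A[X]} {m : ℕ} (hm : 1 ≤ m)
    (ha : (X : A[X]) ^ m ∣ χ.eval a) (hu : (X : A[X]) ∣ 1 - u * (derivative χ).eval a) :
    (X : A[X]) ^ (m + 1) ∣ χ.eval (a - u * χ.eval a) := by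
  obtain ⟨r, hr⟩ := binomExpansion χ a (-(u * χ.eval a))
  rw [sub_eq_add_neg, hr]
  have h1 : χ.eval a + (derivative χ).eval a * -(u * χ.eval a) =
      χ.eval a * (1 - u * (derivative χ).eval a) := by ring
  rw [h1]
  refine dvd_add ?_ ?_
  · rw [pow_succ]
    exact mul_dvd_mul ha hu
  · rw [neg_sq, mul_pow]
    refine Dvd.dvd.mul_left ?_ _
    refine Dvd.dvd.mul_left ?_ _
    calc (X : A[X]) ^ (m + 1) ∣ (X : A[X]) ^ (m * 2) := pow_dvd_pow _ (by omega)
      _ ∣ χ.eval a ^ 2 := by rw [pow_mul]; exact pow_dvd_pow_of_dvd ha 2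

/-- **Newton–Hensel lifting to any finite precision, inside an invariant set.** Let
`S ⊆ A[Y]` contain `C α` and be stable under `a ↦ a - u χ(a)`. If `Y ∣ χ(α)` and
`Y ∣ 1 - u χ'(α)`, then for every `k` some `a ∈ S` has `a ≡ α (mod Y)` and `Y^{k+1} ∣ χ(a)`.
[cite: Kaltofen1995, §3] -/
theorem exists_approxRoot_of_invariant (χ : Polynomial A[X]) (α u : A) (S : Set A[X])
    (hS0 : C α ∈ S) (hS : ∀ a ∈ S, a - C u * χ.eval a ∈ S)
    (hroot : (X : A[X]) ∣ χ.eval (C α))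
    (hunit : (X : A[X]) ∣ 1 - C u * (derivative χ).eval (C α)) (k : ℕ) :
    ∃ a ∈ S, (X : A[X]) ∣ a - C α ∧ (X : A[X]) ^ (k + 1) ∣ χ.eval a := by
  induction k with
  | zero => exact ⟨C α, hS0, by simp, by simpa using hroot⟩
  | succ k ih =>
    obtain ⟨a, haS, hamod, hak⟩ := ih
    refine ⟨a - C u * χ.eval a, hS a haS, ?_, ?_⟩
    · -- `a - uχ(a) ≡ a ≡ α (mod Y)`
      have h1 : (X : A[X]) ∣ χ.eval a := (dvd_pow_self _ (Nat.succ_ne_zero k)).trans hak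
      have : a - C u * χ.eval a - C α = (a - C α) - C u * χ.eval a := by ring
      rw [this]
      exact dvd_sub hamod (h1.mul_left _)
    · -- the derivative condition transfers from `α` to `a ≡ α`
      have hu : (X : A[X]) ∣ 1 - C u * (derivative χ).eval a := by
        have h2 : (X : A[X]) ∣ (derivative χ).eval a - (derivative χ).eval (C α) :=
          dvd_eval_sub_eval hamod _
        have : 1 - C u * (derivative χ).eval a =
            (1 - C u * (derivative χ).eval (C α)) -
              C u * ((derivative χ).eval a - (derivative χ).eval (C α)) := by ring
        rw [this]
        exact dvd_sub hunit (h2.mul_left _)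
      exact newton_step χ (C u) (by omega) hak hu

/-- **Newton–Hensel lifting to any finite precision** (no invariant). [cite: Kaltofen1995, §3] -/
theorem exists_approxRoot (χ : Polynomial A[X]) (α u : A)
    (hroot : (X : A[X]) ∣ χ.eval (C α))
    (hunit : (X : A[X]) ∣ 1 - C u * (derivative χ).eval (C α)) (k : ℕ) :
    ∃ a : A[X], (X : A[X]) ∣ a - C α ∧ (X : A[X]) ^ (k + 1) ∣ χ.eval a := by
  obtain ⟨a, -, h1, h2⟩ := exists_approxRoot_of_invariant χ α u Set.univ (Set.mem_univ _)
    (fun _ _ ↦ Set.mem_univ _) hroot hunit k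
  exact ⟨a, h1, h2⟩

/-! ### Reduction modulo `Y`: checking the hypotheses on `χ(X, 0)` -/

/-- `χ(C α) mod Y = χ(X, 0)(α)`: the constant coefficient of `χ(C α) ∈ A[Y]` is the value at
`α` of the reduction `χ(X, 0) ∈ A[X]`. [folklore] -/
theorem coeff_zero_eval_C (χ : Polynomial A[X]) (α : A) :
    (χ.eval (C α)).coeff 0 = (χ.map (evalRingHom (0 : A))).eval α := by
  have h := Polynomial.hom_eval₂ χ (RingHom.id A[X]) (evalRingHom (0 : A)) (C α)
  rw [eval₂_id, RingHom.comp_id] at h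
  rw [coeff_zero_eq_eval_zero, ← coe_evalRingHom, h, coe_evalRingHom, eval_C, eval_map]

/-- The root hypothesis from the reduction: if `χ(X,0)(α) = 0` then `Y ∣ χ(C α)`. [folklore] -/
theorem X_dvd_eval_C_of_eval_eq_zero (χ : Polynomial A[X]) {α : A}
    (h : (χ.map (evalRingHom (0 : A))).eval α = 0) : (X : A[X]) ∣ χ.eval (C α) := by
  rw [X_dvd_iff, coeff_zero_eval_C, h]

/-- The unit hypothesis from the reduction: if `u · χ(X,0)'(α) = 1` then `Y ∣ 1 - u χ'(C α)`.
[folklore] -/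
theorem X_dvd_one_sub_of_eval_derivative (χ : Polynomial A[X]) {α u : A}
    (h : u * (derivative (χ.map (evalRingHom (0 : A)))).eval α = 1) :
    (X : A[X]) ∣ 1 - C u * (derivative χ).eval (C α) := by
  rw [X_dvd_iff, coeff_sub, coeff_one_zero, coeff_C_mul, coeff_zero_eval_C,
    ← derivative_map, h, sub_self]

end Literature.NumberTheory.DiophantineGeometry
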